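import Summits.AtomisticToContinuum.HydrodynamicLimit.Theorems.CollisionIsometryCLTAdaptedWeightCLTBlockHDissipationB
import Summits.AtomisticToContinuum.HydrodynamicLimit.Theorems.CollisionIsometryCLTAdaptedWeightCLTBHEntropyBudget
import Summits.AtomisticToContinuum.HydrodynamicLimit.Theorems.CollisionIsometryCLTAdaptedWeightCLTBHEEPClosure
import Summits.AtomisticToContinuum.HydrodynamicLimit.Theorems.CollisionIsometryCLTAdaptedWeightCLTBHFewCollisionsReduction

/-!
# Skeleton v3 of the line `block-h-dissipation-closure` for the crux `AdaptedWeightCLT`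
(stmt-AtomisticToContinuum-14868, rev-12 TIME-LOCAL form; route `CollisionIsometryCLT`, sub-problem
`HydrodynamicLimit`; lead `prover-line-stmt-AtomisticToContinuum-14868-c4-0`, planner
`planner-cruxplan-stmt-AtomisticToContinuum-14868-block-h-dissipation--0`)

v3 = RESHAPE after wave 1 (six workers, 2026-08-17). Of the planner's seven stubs, S1 (entropy budget), S2 (Donsker–
Varadhan transfer), S5 (EEP closure) and S6 (coarsening) are LANDED CONDITIONALLY on their honest inputs, and S0 is
reduced to an existing open item:
* S1 = `budgetDecompOn_of_bregSmall` (…BHEntropyBudget, p171303: exact telescoping identity on good orbits + |S_N|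
  bound + transport rate, 13 files) GIVEN `BregSmallOn` — NEW registered stub `stub_bregSmall` (lonely-contact class);
* S2 = `dvTransferStub'_holds` (…BHDVTransferInputs, p166600: abstract DV, exact Hellinger identity, chaos/contact
  normalisation, `dv_step`, glue, 12 files) GIVEN G1 ∧ G3 ∧ G4 — NEW stub `stub_dvCommutators` — and G2 — NEW stub
  `stub_dvAggregate` (provable bookkeeping);
* S5 = `bhEEPClosure_conditional` (…BHEEPClosure, p171308, 11 files) GIVEN the Literature fact
  `Literature.MathematicalPhysics.KineticTheory.HardSphereEEP` (Rezakhanlou–Villani LNM 1916 Thm 4 = Villani 2003 Thm 2.1,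
  relocated p170154) — a NAMED-FACT HYPOTHESIS of the composition (not a stub);
* S6 = `bhCoarsening_of_reynolds` (…BHCoarsening, p170223: admissible cell family exists, Germano identity with
  smooth weights, 7 files) GIVEN `SubBlockReynoldsOn` — NEW stub `stub_reynoldsBH` (declared hydro-class exposure);
* S0 in `∃ σ₀` form — NEW stub `stub_fewCollisionsSmallSigma` — is `fewCollisionsOn_of_collisionMomentBound`
  (…BHFewCollisionsReduction, p164612) applied to the open support item
  `Theses.InformationPercolationEngine.CollisionMomentBound` (stmt-AtomisticToContinuum-15144): blocked-on that item;
  its equilibrium rung `fewCollisionsOn_const` (every flow, constant profiles) is landed (p164367, p164899);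
* S3 `stub_entropyChaosRel` (THE RESIDUE, lead) and S4 `stub_contactToMass` (XL; six helper files landed p164320
  p164510 p165054 p165605 p165501 p166028; repair plan = mass-clock charging) are unchanged.
Registered stubs of v3 (seven): `stub_fewCollisionsSmallSigma`, `stub_perContact` (BregSmall ∧ G1 ∧ G3 ∧ G4),
`stub_dvAggregate`, `stub_entropyChaosRel`, `stub_contactToMass`, `stub_reynoldsBH`, `stub_hardSphereEEP` (the cited fact); statements in the vocabulary
modules `…BlockHDissipation` (A, p163217) and `…BlockHDissipationB` (B, p171373). Composition `AdaptedWeightCLT_of`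
/ `AdaptedWeightCLT_of_stubs` proved below: `σ₀ := min (min σ₀(S3) σ₀(S0)) (min σ₀(S6′) 2⁻¹)`,
`γc := 1/4`, `h := δ := 1/2`.
-/

namespace Summit.AtomisticToContinuum.HydrodynamicLimit.Cruxes.AdaptedWeightCLT.BlockHDissipationClosure

open scoped BigOperators Topology Classical MeasureTheory ENNReal InnerProductSpace
open Filter Set MeasureTheory
open Literature.Analysis.FluidPDE
open Summit.AtomisticToContinuum.HydrodynamicLimit.Theorems.ContactSourceDuhamel (T3 V3 Cfg Vel Flow Flows)
open Summit.AtomisticToContinuum.HydrodynamicLimit.Theorems.ContactSourceDuhamel.TimeLocal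
open Summit.AtomisticToContinuum.HydrodynamicLimit.Theorems.BlockHDissipation
open Literature.MathematicalPhysics.KineticTheory (hsDiameter localGibbsLaw collide hardSphereKernel
  sphereMeasure HardSphereEEP)

noncomputable section

/-! ## §3 Registered stubs of v3 (`stub_*`, bodies `sorry`) -/

/-- **S0′ — FEW COLLISIONS for small reduced density (`∃ σ₀` form; blocked-on stmt-15144).** For nice profiles there
is `σ₀ > 0` such that for `0 < σ < σ₀`, every flow family and `t > 0`: `FewCollisionsOn`. Equals
`fewCollisionsOn_of_collisionMomentBound h` for `h : Theses.InformationPercolationEngine.CollisionMomentBound`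
(stmt-AtomisticToContinuum-15144, open support item of route InformationPercolationEngine: tightness of the
energy-weighted contact count under the local Gibbs law); equilibrium rung landed (`fewCollisionsOn_const`). -/
theorem stub_fewCollisionsSmallSigma : ∀ (a₀ θ₀ : T3 → ℝ) (u₀ : T3 → V3), NiceProfiles a₀ θ₀ u₀ →
    ∃ σ₀ : ℝ, 0 < σ₀ ∧ ∀ σ : ℝ, 0 < σ → σ < σ₀ →
    ∀ (Φ : Flows σ) (t : ℝ), 0 < t → FewCollisionsOn σ a₀ θ₀ u₀ Φ t := by
  sorry

/-- **S1′∧S2′ — THE PER-CONTACT INPUTS (Bregman sum + the three DV commutators; ONE registered stub, lonely-contact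
class).** For nice profiles, `0 < σ < 1/2`, an admissible cell family at `γc ∈ (1/6,1/3)`, every flow family and `t > 0`
with H2 and few collisions, and every `(h,δ) ∈ (0,1)²`:
`BregSmallOn` (∀ p > 0, `P_N{(N+1)^{γc+p} < bregS} → 0`: the residual input of the entropy budget S1 =
`budgetDecompOn_of_bregSmall`) ∧ `IncrToMeasureOn` (G1: realised first-order dissipation ≥ `(1−δ)` × DV action of the
non-junk cell-windows) ∧ `CrossHellingerOn` (G3: smeared cross-Hellinger mass ≥ `chaosDissW`; exact `0 = 0` at local
equilibrium, kit j022218 ratio ∈ [1.10, 3.10] in 54 non-equilibrium families) ∧ `ChaosTimeOn` (G4: `chaosDiss ≤ K₀·chaosDissW`)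
— the inputs of S2 = `dvTransferStub'_holds`. CONTENT (why one stub): every conjunct is a sum over contacts of a per-contact
remainder that is `≲ (N+1)⁻¹(m_cell h³δ)⁻¹`-small at POPULOUS contact velocities (`f̂_pre(w) ≳ α h⁻³`) and up to
`O((log N + |v−ū|²/(θ̄+h²))/(N+1))` at LONELY ones; `FewCollisionsOn` allows `(N+1)^{4/3+p}` contacts, so the common content
is a census "lonely contacts are `o((N+1)^{1+γc})`" (energy + TailsOn cap lonely PARTICLES at `≲ h⁻³(log N)^{3/2}(N+1)^{1/3+2γc}`
per time, S1 worker; nothing typed caps their collision RATE). -/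
theorem stub_perContact : ∀ (a₀ θ₀ : T3 → ℝ) (u₀ : T3 → V3), NiceProfiles a₀ θ₀ u₀ → ∀ σ : ℝ, 0 < σ → σ < 2⁻¹ →
    ∀ (γc C' : ℝ) (ψ : ℕ → T3 → ℝ), 1 / 6 < γc → γc < 1 / 3 → AdmissibleKernel γc C' ψ →
      ∀ (Φ : Flows σ) (t : ℝ), 0 < t → TailsOn σ a₀ θ₀ u₀ Φ t → FewCollisionsOn σ a₀ θ₀ u₀ Φ t →
        ∀ h δ : ℝ, 0 < h → h < 1 → 0 < δ → δ < 1 →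
          BregSmallOn σ a₀ θ₀ u₀ Φ ψ γc h δ t ∧ IncrToMeasureOn σ a₀ θ₀ u₀ Φ ψ γc h δ t ∧
            CrossHellingerOn σ a₀ θ₀ u₀ Φ ψ γc h δ t ∧ ChaosTimeOn σ a₀ θ₀ u₀ Φ ψ γc h δ t := by
  sorry

/-- **S2″ — THE AGGREGATE DV STEP (G2; provable bookkeeping).** Same prefix, then `DVAggregateOn`
(`dvActW + η(N+1)^{1/3} ≥ crossEW − relEnt` w.h.p.): `dv_step′` (…BHDVTransfer, unconditional per good orbit and
non-junk cell-window: `crossE − klTerm ≤ dvAct`) integrated in `x` and summed over `k < nWin`; reduced there to the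
a.e.-`z` integrability on 𝕋³ of `cellOK·crossE`, `klTerm`, `cellOK·dvAct` (`dvAggregateOn_of_xIntegrable`), i.e. to
`x`-measurability + `x`-uniform bounds of three parametric integrals, all bounded on a good orbit by the envelopes of
…BHDVTransferCellLaw/Moments/LogChaos. -/
theorem stub_dvAggregate : ∀ (a₀ θ₀ : T3 → ℝ) (u₀ : T3 → V3), NiceProfiles a₀ θ₀ u₀ → ∀ σ : ℝ, 0 < σ → σ < 2⁻¹ →
    ∀ (γc C' : ℝ) (ψ : ℕ → T3 → ℝ), 1 / 6 < γc → γc < 1 / 3 → AdmissibleKernel γc C' ψ →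
      ∀ (Φ : Flows σ) (t : ℝ), 0 < t → TailsOn σ a₀ θ₀ u₀ Φ t → FewCollisionsOn σ a₀ θ₀ u₀ Φ t →
        ∀ h δ : ℝ, 0 < h → h < 1 → 0 < δ → δ < 1 → DVAggregateOn σ a₀ θ₀ u₀ Φ ψ γc h δ t := by
  sorry

/-- **S3 — RELATIVE ENTROPY-CHAOS AT CONTACT (THE RESIDUE; open, XL).** For nice profiles there is `σ₀ > 0`
such that for `0 < σ < σ₀`, every admissible cell family (`γc ∈ (1/6,1/3)`), `(h, δ) ∈ (0,1)²`, every flow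
family with diffuse backward influence (H1) and every `t > 0` with H2 on `[0, t]`: `∃ c₀ ∈ (0,1] ∀ η > 0`,
`P_N{relEnt > (1 − c₀) chaosDissW + η (N+1)^{1/3}} → 0`.
CONTENT. A two-particle statement — the lifted, `G_h^{⊗4}`-smeared empirical law of the contact quadruples
`(v⁻, v_*⁻, v⁺, v_*⁺)` of each (cell, window) against the identically smeared chaotic law of the cell's OWN atoms —
with a canonical left side (no chosen test functional, so it cannot degenerate at the goal: it is NOT implied by
`C⁺` plus the budget, which only yield a LOWER bound on `relEnt`, r1-3 note A), RELATIVE to the Hellinger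
dissipation as Disproof F4 forces (at fixed `σ` rings and prompt recollisions give `KL ≍ σ⁶ A²` against
`𝒟h ≍ A²`, `A` = local non-Maxwellian amplitude; measured bilinear relative defects `4–21 %` at `φ = 0.01–0.3`,
kit j017504–j017766), `∃ σ₀` doing the absorbing. Equilibrium rung = a law of large numbers for the smeared
empirical contact process (`m_cell ν_N Δ_N → ∞` contacts per cell-window at fixed `h`): `E contactDens =
contactMass • chaosDens` when contacts pair the cell's atoms with flux weight, so `KL → 0` there. Fails SURELY on
velocity-reversed states (as it must) and at shock- or contact-discontinuity-straddling cells (volume `≍ (N+1)^{-γc}·area → 0`,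
absorbed by the absolute slack). H1 is available (degenerate-normal conspiracies have `ipr ≥ 1`,
`one_le_ipr_of_planar`); H2 prices the tail fringe. [size XL; open — Stosszahlansatz-class, one-sided-usable form] -/
theorem stub_entropyChaosRel : ∀ (a₀ θ₀ : T3 → ℝ) (u₀ : T3 → V3), NiceProfiles a₀ θ₀ u₀ →
    ∃ σ₀ : ℝ, 0 < σ₀ ∧ ∀ σ : ℝ, 0 < σ → σ < σ₀ →
    ∀ (γc C' : ℝ) (ψ : ℕ → T3 → ℝ), 1 / 6 < γc → γc < 1 / 3 → AdmissibleKernel γc C' ψ →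
      ∀ h δ : ℝ, 0 < h → h < 1 → 0 < δ → δ < 1 → ∀ Φ : Flows σ, DiffuseAt σ a₀ θ₀ u₀ Φ →
        ∀ t : ℝ, 0 < t → TailsOn σ a₀ θ₀ u₀ Φ t → EntropyChaosRelOn σ a₀ θ₀ u₀ Φ ψ γc h δ t := by
  sorry

/-- **S4 — CONTACT-CHARGED ⇒ MASS-WEIGHTED (H1 at work; provable now, M).** For nice profiles, `0 < σ < 1/2`,
an admissible cell family, `(h,δ) ∈ (0,1)²`, a flow family with DIFFUSE BACKWARD INFLUENCE (H1) and `t > 0` with H2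
on `[0,t]`: `ChaosSmallOn ⇒ DissipSmallOn`.
MECHANISM. `𝒟h(f̂_{s,x})` changes only at contacts of the cell's particles (by `O(1/m_cell)` per contact in the
bulk; tail atoms priced by `TailsOn`) and by transport (`O(v (N+1)^{γc} Δ) → 0` per H1-window). By H1, on every
kinetic window `Δ_N → 0`, `Δ_N (N+1)^{1/3} → ∞` all but an `L¹(P)`-vanishing mass fraction of particles collide
(a collision-free particle has row `ipr = 9`: Disproof §2 `ipr_of_collisionCount_eq_zero`, tree
`nine_mul_idleFrac_le_ipr`), so mass-time where `𝒟h ≥ κ` is charged to `chaosDiss` at rate `≥ m / Δ_N → ∞` per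
unit mass-time unless idle; choosing the H1 windows after a diagonal `η_N → 0` for `ChaosSmallOn` gives
`massDiss ≤ η_N n_N t / m + idle → 0`. The certified necessity content of H1 (no contacts ⇒ no dissipation ⇒ no
conversion: the laned / planar-normal kernels, `one_le_ipr_of_planar`) is exactly what this stub consumes.
[size M; provable now] -/
theorem stub_contactToMass : ∀ (a₀ θ₀ : T3 → ℝ) (u₀ : T3 → V3), NiceProfiles a₀ θ₀ u₀ →
    ∀ σ : ℝ, 0 < σ → σ < 2⁻¹ →
    ∀ (γc C' : ℝ) (ψ : ℕ → T3 → ℝ), 1 / 6 < γc → γc < 1 / 3 → AdmissibleKernel γc C' ψ →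
      ∀ h δ : ℝ, 0 < h → h < 1 → 0 < δ → δ < 1 → ∀ Φ : Flows σ, DiffuseAt σ a₀ θ₀ u₀ Φ →
        ∀ t : ℝ, 0 < t → TailsOn σ a₀ θ₀ u₀ Φ t →
          ChaosSmallOn σ a₀ θ₀ u₀ Φ ψ h δ t → DissipSmallOn σ a₀ θ₀ u₀ Φ ψ h δ t := by
  sorry

/-- **S6′ — THE SUB-BLOCK REYNOLDS REMAINDER (declared hydro-class exposure; open).** For nice profiles there is
`σ₀ > 0` such that for `0 < σ < σ₀`, `γc ∈ (1/6,1/3)`, every flow family with H1, every admissible block family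
(`γ ≤ 1/15`) and `t > 0` with H2: `SubBlockReynoldsOn σ a₀ θ₀ u₀ Φ γc φ t` — the Germano-density Reynolds functional
`ReynG = ∫₀ᵗ∫ₓ ethG·reyG` (density-weighted quadratic + quartic fluctuation of the ψ-smeared cell velocity against the
block velocity) vanishes in probability for every admissible cell family. Thermal cell-mean noise `θ/m_cell → 0`;
pre-shock MesoQuiescence-class (`Theses.GermanoSplitLES.MesoQuiescence`, stmt-9198, same currency, not implying it
verbatim); post-shock = the crux's own `∀ t > 0` exposure (Disproof §1c/§6, repair C′ = PreShock). Nearest landed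
statement: `SustainedAnisotropy.ReynoldsStub` (cell velocities sampled AT particles; neither implies the other
verbatim); its equilibrium rung `stub_reynolds_const` is landed (p144835). -/
theorem stub_reynoldsBH : ∀ (a₀ θ₀ : T3 → ℝ) (u₀ : T3 → V3), NiceProfiles a₀ θ₀ u₀ →
    ∃ σ₀ : ℝ, 0 < σ₀ ∧ ∀ σ : ℝ, 0 < σ → σ < σ₀ →
    ∀ γc : ℝ, 1 / 6 < γc → γc < 1 / 3 → ∀ Φ : Flows σ, DiffuseAt σ a₀ θ₀ u₀ Φ →
      ∀ (γ C : ℝ) (φ : ℕ → T3 → ℝ), 0 < γ → γ ≤ 1 / 15 → AdmissibleKernel γ C φ →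
        ∀ t : ℝ, 0 < t → TailsOn σ a₀ θ₀ u₀ Φ t → SubBlockReynoldsOn σ a₀ θ₀ u₀ Φ γc φ t := by
  sorry

/-- **S5′ — THE CITED FACT (closed modulo `HardSphereEEP_holds`).** Villani's entropy–entropy-production inequality for
the hard-sphere collision operator (Villani, CMP 234 (2003) Thm 2.1 = Rezakhanlou–Villani LNM 1916 Ch. 1 Thm 4, pp. 25–26),
special-cased to regularised velocity-cloud laws: the Literature named fact
`Literature.MathematicalPhysics.KineticTheory.HardSphereEEP` (relocated p170154; statement as printed + WHY the special case
follows, in its docstring). S5 = `bhEEPClosure_conditional` consumes it. A published theorem, not a conjecture; its discharge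
`HardSphereEEP_holds` is literature-prover debt (XL: needs `H^k(ℝ³)` machinery). -/
theorem stub_hardSphereEEP : HardSphereEEP := by
  sorry

/-! ## §4 Composition (proved): the seven stubs of v3 + the Literature fact `HardSphereEEP` give the crux BY NAME -/

/-- Negative powers of `N + 1` tend to zero. -/
theorem tendsto_natSucc_rpow_neg {e : ℝ} (he : e < 0) :
    Tendsto (fun N : ℕ => ((N + 1 : ℕ) : ℝ) ^ e) atTop (𝓝 0) := by
  have hcast : Tendsto (fun N : ℕ => ((N + 1 : ℕ) : ℝ)) atTop atTop :=
    tendsto_natCast_atTop_atTop.comp (tendsto_add_atTop_nat 1)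
  have h := (tendsto_rpow_neg_atTop (by linarith : 0 < -e)).comp hcast
  simpa [Function.comp_def, neg_neg] using h

/-- DETERMINISTIC + PROBABILISTIC CORE of the composition: the budget (`realDiss ≤ (N+1)^{γc+p}` w.h.p.) and the
one-sided chaos inequality (`realDiss + η (N+1)^{1/3} ≥ c₁ chaosDiss` w.h.p.) force `chaosDiss = o((N+1)^{1/3})`
in probability, because `γc + p < 1/3` for `p := (1/3 − γc)/2`. -/
theorem chaosSmall_of_oneSided_of_budget {σ : ℝ} {a₀ θ₀ : T3 → ℝ} {u₀ : T3 → V3} {Φ : Flows σ}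
    {ψ : ℕ → T3 → ℝ} {γc h δ t : ℝ} (hγc : γc < 1 / 3)
    (hB : BudgetOn σ a₀ θ₀ u₀ Φ ψ γc h δ t) (hO : OneSidedOn σ a₀ θ₀ u₀ Φ ψ h δ t) :
    ChaosSmallOn σ a₀ θ₀ u₀ Φ ψ h δ t := by
  intro η hη
  obtain ⟨c₁, hc₁, hO⟩ := hO
  set p : ℝ := (1 / 3 - γc) / 2 with hp_def
  have hp : 0 < p := by rw [hp_def]; linarith
  have hexp : γc + p - 1 / 3 < 0 := by rw [hp_def]; linarith
  -- the two bad events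
  let EA : (N : ℕ) → Set (Cfg N) := fun N =>
    {z | ((N + 1 : ℕ) : ℝ) ^ (γc + p) < realDiss σ N (Φ N) ψ h δ t z}
  let EB : (N : ℕ) → Set (Cfg N) := fun N =>
    {z | realDiss σ N (Φ N) ψ h δ t z + (c₁ * η / 2) * ((N + 1 : ℕ) : ℝ) ^ ((1 : ℝ) / 3) <
      c₁ * chaosDiss σ N (Φ N) ψ h δ t z}
  have hA : Tendsto (fun N : ℕ => localGibbsLaw σ a₀ u₀ θ₀ N (Φ N) (EA N)) atTop (𝓝 0) := hB p hp
  have hBt : Tendsto (fun N : ℕ => localGibbsLaw σ a₀ u₀ θ₀ N (Φ N) (EB N)) atTop (𝓝 0) :=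
    hO (c₁ * η / 2) (by positivity)
  have hpos : ∀ N : ℕ, (0 : ℝ) < ((N + 1 : ℕ) : ℝ) := fun N => by exact_mod_cast Nat.succ_pos N
  -- eventually the margin closes: (N+1)^{γc+p} ≤ (c₁ η / 2) (N+1)^{1/3}
  have hmargin : ∀ᶠ N : ℕ in atTop,
      ((N + 1 : ℕ) : ℝ) ^ (γc + p) ≤ (c₁ * η / 2) * ((N + 1 : ℕ) : ℝ) ^ ((1 : ℝ) / 3) := by
    have hsmall : ∀ᶠ N : ℕ in atTop, ((N + 1 : ℕ) : ℝ) ^ (γc + p - 1 / 3) < c₁ * η / 2 :=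
      (tendsto_natSucc_rpow_neg hexp).eventually (gt_mem_nhds (by positivity))
    filter_upwards [hsmall] with N hN
    have hN1 := hpos N
    have hsplit : ((N + 1 : ℕ) : ℝ) ^ (γc + p) =
        ((N + 1 : ℕ) : ℝ) ^ (γc + p - 1 / 3) * ((N + 1 : ℕ) : ℝ) ^ ((1 : ℝ) / 3) := by
      rw [← Real.rpow_add hN1]; congr 1; ring
    rw [hsplit]
    have h13 : 0 ≤ ((N + 1 : ℕ) : ℝ) ^ ((1 : ℝ) / 3) := (Real.rpow_pos_of_pos hN1 _).le
    exact mul_le_mul_of_nonneg_right hN.le h13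
  have hincl : ∀ᶠ N : ℕ in atTop,
      {z | η * ((N + 1 : ℕ) : ℝ) ^ ((1 : ℝ) / 3) < chaosDiss σ N (Φ N) ψ h δ t z} ⊆ EA N ∪ EB N := by
    filter_upwards [hmargin] with N hN z hz
    simp only [mem_setOf_eq] at hz
    by_contra hnot
    simp only [mem_union, mem_setOf_eq, not_or, not_lt, EA, EB] at hnot
    obtain ⟨hzA, hzB⟩ := hnot
    -- from ¬EB: c₁ chaosDiss ≤ realDiss + (c₁η/2) N^{1/3}; from ¬EA: realDiss ≤ N^{γc+p} ≤ (c₁η/2) N^{1/3}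
    have h1 : c₁ * (η * ((N + 1 : ℕ) : ℝ) ^ ((1 : ℝ) / 3)) < c₁ * chaosDiss σ N (Φ N) ψ h δ t z :=
      mul_lt_mul_of_pos_left hz hc₁
    nlinarith [hzA, hzB, hN, h1]
  have hle : ∀ᶠ N : ℕ in atTop, localGibbsLaw σ a₀ u₀ θ₀ N (Φ N)
      {z | η * ((N + 1 : ℕ) : ℝ) ^ ((1 : ℝ) / 3) < chaosDiss σ N (Φ N) ψ h δ t z} ≤
      localGibbsLaw σ a₀ u₀ θ₀ N (Φ N) (EA N) + localGibbsLaw σ a₀ u₀ θ₀ N (Φ N) (EB N) := by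
    filter_upwards [hincl] with N hN
    exact (measure_mono hN).trans (measure_union_le _ _)
  have hsum : Tendsto (fun N : ℕ => localGibbsLaw σ a₀ u₀ θ₀ N (Φ N) (EA N) +
      localGibbsLaw σ a₀ u₀ θ₀ N (Φ N) (EB N)) atTop (𝓝 0) := by
    simpa using hA.add hBt
  exact tendsto_of_tendsto_of_tendsto_of_le_of_le' tendsto_const_nhds hsum
    (Eventually.of_forall fun N => bot_le) hle

/-- **THE COMPOSITION (v3).** The seven registered stubs of v3 and the cited fact `HardSphereEEP` give the crux
`CollisionIsometryCLT.AdaptedWeightCLT` (rev-12, time-local form) BY NAME: `adaptedWeightCLT_iff` (`Iff.rfl`),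
`σ₀ := min (min σ₀(S3) σ₀(S0′)) (min σ₀(S6′) 2⁻¹)`, per horizon `cruxTailT_of_conclOn` and `conclOn_iff`; for each block
family the cell closure is produced for EVERY admissible cell family at `γc := 1/4`, `h := δ := 1/2`
(S0′ ⇒ few collisions; S1′ + `budgetDecompOn_of_bregSmall` ⇒ budget; S3 ⇒ residue; S2′ + S2″ + `dvTransferStub'_holds`
⇒ one-sided; `chaosSmall_of_oneSided_of_budget`; S4; `bhEEPClosure_conditional hEEP`) and coarsened by
`bhCoarsening_of_reynolds` with S6′. H1 is consumed by S3, S4, S6′; H2 by everything. -/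
theorem AdaptedWeightCLT_of (hEEP : HardSphereEEP) (h0 : FewCollisionsSmallSigmaStub)
    (hP : ∀ (a₀ θ₀ : T3 → ℝ) (u₀ : T3 → V3), NiceProfiles a₀ θ₀ u₀ → ∀ σ : ℝ, 0 < σ → σ < 2⁻¹ →
      ∀ (γc C' : ℝ) (ψ : ℕ → T3 → ℝ), 1 / 6 < γc → γc < 1 / 3 → AdmissibleKernel γc C' ψ →
        ∀ (Φ : Flows σ) (t : ℝ), 0 < t → TailsOn σ a₀ θ₀ u₀ Φ t → FewCollisionsOn σ a₀ θ₀ u₀ Φ t →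
          ∀ h δ : ℝ, 0 < h → h < 1 → 0 < δ → δ < 1 →
            BregSmallOn σ a₀ θ₀ u₀ Φ ψ γc h δ t ∧ IncrToMeasureOn σ a₀ θ₀ u₀ Φ ψ γc h δ t ∧
              CrossHellingerOn σ a₀ θ₀ u₀ Φ ψ γc h δ t ∧ ChaosTimeOn σ a₀ θ₀ u₀ Φ ψ γc h δ t)
    (hA : DVAggregateStub) (h3 : EntropyChaosRelStub) (h4 : ContactToMassStub) (hR : ReynoldsBHStub) :
    Summit.AtomisticToContinuum.HydrodynamicLimit.Theses.CollisionIsometryCLT.AdaptedWeightCLT := by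
  rw [adaptedWeightCLT_iff]
  intro a₀ θ₀ u₀ ha hθ hu ha0 hθ0
  have hnice : NiceProfiles a₀ θ₀ u₀ := ⟨ha, hθ, hu, ha0, hθ0⟩
  obtain ⟨σ₃, hσ₃, H3⟩ := h3 a₀ θ₀ u₀ hnice
  obtain ⟨σ₁, hσ₁, H0⟩ := h0 a₀ θ₀ u₀ hnice
  obtain ⟨σ₆, hσ₆, HR⟩ := hR a₀ θ₀ u₀ hnice
  refine ⟨min (min σ₃ σ₁) (min σ₆ 2⁻¹), lt_min (lt_min hσ₃ hσ₁) (lt_min hσ₆ (by norm_num)),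
    fun σ hσ hσlt Φ hDiff => ?_⟩
  have hσ₃' : σ < σ₃ := lt_of_lt_of_le hσlt ((min_le_left _ _).trans (min_le_left _ _))
  have hσ₁' : σ < σ₁ := lt_of_lt_of_le hσlt ((min_le_left _ _).trans (min_le_right _ _))
  have hσ₆' : σ < σ₆ := lt_of_lt_of_le hσlt ((min_le_right _ _).trans (min_le_left _ _))
  have hσ2 : σ < 2⁻¹ := lt_of_lt_of_le hσlt ((min_le_right _ _).trans (min_le_right _ _))
  refine cruxTailT_of_conclOn fun t ht hT => ?_
  rw [conclOn_iff]
  intro γ C φ hγ hγ' hadm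
  have hγc1 : (1 : ℝ) / 6 < 1 / 4 := by norm_num
  have hγc2 : (1 : ℝ) / 4 < 1 / 3 := by norm_num
  refine bhCoarsening_of_reynolds a₀ θ₀ u₀ hnice σ hσ hσ2 (1 / 4) hγc1 hγc2 Φ γ C φ hγ hγ' hadm t ht hT
    (HR σ hσ hσ₆' (1 / 4) hγc1 hγc2 Φ hDiff γ C φ hγ hγ' hadm t ht hT) fun C' ψ hψ => ?_
  -- cell closure for the cell family ψ at exponent 1/4, regularisation h = δ = 1/2
  have hh : (0 : ℝ) < 1 / 2 := by norm_num
  have hh1 : (1 : ℝ) / 2 < 1 := by norm_num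
  have HF : FewCollisionsOn σ a₀ θ₀ u₀ Φ t := H0 σ hσ hσ₁' Φ t ht
  obtain ⟨HBr, HG1, HG3, HG4⟩ := hP a₀ θ₀ u₀ hnice σ hσ hσ2 (1 / 4) C' ψ hγc1 hγc2 hψ Φ t ht hT HF
    (1 / 2) (1 / 2) hh hh1 hh hh1
  have HG2 : DVAggregateOn σ a₀ θ₀ u₀ Φ ψ (1 / 4) (1 / 2) (1 / 2) t :=
    hA a₀ θ₀ u₀ hnice σ hσ hσ2 (1 / 4) C' ψ hγc1 hγc2 hψ Φ t ht hT HF (1 / 2) (1 / 2) hh hh1 hh hh1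
  have HRes : EntropyChaosRelOn σ a₀ θ₀ u₀ Φ ψ (1 / 4) (1 / 2) (1 / 2) t :=
    H3 σ hσ hσ₃' (1 / 4) C' ψ hγc1 hγc2 hψ (1 / 2) (1 / 2) hh hh1 hh hh1 Φ hDiff t ht hT
  have HO : OneSidedOn σ a₀ θ₀ u₀ Φ ψ (1 / 2) (1 / 2) t :=
    dvTransferStub'_holds a₀ θ₀ u₀ hnice σ hσ hσ2 (1 / 4) C' ψ hγc1 hγc2 hψ Φ t ht hT HF (1 / 2) (1 / 2)
      hh hh1 hh hh1 HG1 HG2 HG3 HG4 HRes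
  have HB : BudgetOn σ a₀ θ₀ u₀ Φ ψ (1 / 4) (1 / 2) (1 / 2) t := budgetOn_of_decomp
    (budgetDecompOn_of_bregSmall a₀ θ₀ u₀ hnice σ hσ hσ2 (1 / 4) C' ψ hγc1 hγc2 hψ (1 / 2) (1 / 2) hh hh1 hh hh1
      Φ t ht hT HF HBr)
  have HC : ChaosSmallOn σ a₀ θ₀ u₀ Φ ψ (1 / 2) (1 / 2) t := chaosSmall_of_oneSided_of_budget hγc2 HB HO
  have HD : DissipSmallOn σ a₀ θ₀ u₀ Φ ψ (1 / 2) (1 / 2) t :=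
    h4 a₀ θ₀ u₀ hnice σ hσ hσ2 (1 / 4) C' ψ hγc1 hγc2 hψ (1 / 2) (1 / 2) hh hh1 hh hh1 Φ hDiff t ht hT HC
  exact bhEEPClosure_conditional hEEP a₀ θ₀ u₀ hnice σ hσ hσ2 (1 / 4) C' ψ hγc1 hγc2 hψ (1 / 2) (1 / 2) hh hh1 hh hh1
    Φ t ht hT HD

/-- The crux from the seven stubs of v3 as stated (the only sorries are inside `stub_*`; `stub_hardSphereEEP` is the cited
Literature fact, closed modulo `HardSphereEEP_holds`). -/
theorem AdaptedWeightCLT_of_stubs :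
    Summit.AtomisticToContinuum.HydrodynamicLimit.Theses.CollisionIsometryCLT.AdaptedWeightCLT :=
  AdaptedWeightCLT_of stub_hardSphereEEP stub_fewCollisionsSmallSigma stub_perContact stub_dvAggregate
    stub_entropyChaosRel stub_contactToMass stub_reynoldsBH

/-- Bookkeeping link for S0′: the open support item stmt-15144 discharges `stub_fewCollisionsSmallSigma`. -/
theorem fewCollisionsSmallSigma_of_collisionMomentBound
    (h : Summit.AtomisticToContinuum.HydrodynamicLimit.Theses.InformationPercolationEngine.CollisionMomentBound) :
    FewCollisionsSmallSigmaStub :=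
  fun a₀ θ₀ u₀ hn => FewCollisions.fewCollisionsOn_of_collisionMomentBound h a₀ θ₀ u₀ hn

end

end Summit.AtomisticToContinuum.HydrodynamicLimit.Cruxes.AdaptedWeightCLT.BlockHDissipationClosure
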